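import Mathlib
import Literature.Analysis.FluidPDE.SelfSimilar
import Summits.NavierStokesRegularity.NavierStokesRegularity.Theorems.LiouvilleConjectureNS
import HarnessLib

/-!
# (L) ⇒ every member of the census class is a.e. zero — a found profile would REFUTE the KNSS Liouville
  conjecture (T9 `WallOfL`, narrowed per lead A85/A89; route `DssFarFieldSlaving`, crux
  `BlowupTypeIDssProfile`, stmt-NavierStokesRegularity-0155 — SUPPORT; cell pub-ns-dss, statements and
  proofs: theory seat g3, `HOME/theory/WallOfLTree.lean` sha256[16] cc05f74c4871b6d0; the typer kept ONLY
  the two declarations not already in the tree and removed the local notation — nothing else)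

HONEST FRAMING (theory seat g3, kept). What this is: the CONDITIONAL framing statement of the cell's
Liouville side, kernel-checked — under the bounded-ancient Liouville conjecture (L) of
Koch–Nadirashvili–Seregin–Šverák (`Summit.NavierStokesRegularity.NavierStokesRegularity.LiouvilleConjectureNS`,
OPEN, a conjecture leaf of our theories, not a literature fact; it enters as a HYPOTHESIS `hL`, so the main
theorem is a conditional result) EVERY member of the census class (ancient mild in the duality form,
measurable slices, Type-I space–time bound `‖u(t,x)‖ ≤ C₀/(‖x‖ + √(−t))`) is a.e. zero on every slice —
for every Type-I constant, WITHOUT using self-similarity, twist or symmetry. Consequently a certified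
census witness (a genuine backward rotated-DSS Type-I profile instantiating the landed amplification
theorem) would be a COUNTEREXAMPLE to (L); an empty census can never confirm (L) (lead A85 framing
sentence). What this is NOT: no claim about Navier–Stokes regularity or blow-up, no claim that (L) holds
or fails, no theorem concluding `¬ (L)` or the negation of any Theses constant; nothing numerical.

Mechanism (KNSS 2009 §1 / Albritton–Barker 2019 §1 «if true, the conjecture excludes Type I
singularities», elementary half): after the time shift `τ ↦ u(τ + t/2)` a Type-I ancient mild field is
a BOUNDED ancient mild solution (the tree's `HasTypeITimeDecay.isBoundedOn` and
`IsAncientMildSolution.time_translate`, exactly as in `typeI_ancient_axisymmetric_ae_zero`); (L) makes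
its slice at `τ = t/2`, i.e. `u t`, a.e. equal to a constant `b`; the spatial Type-I decay forces
`b = 0` (`ae_const_eq_zero_of_hasTypeIDecay`: open sets have positive Lebesgue measure, so the a.e.
identity `u t = b` is attained at points of arbitrarily large norm, where `‖u t x‖ ≤ C₀/‖x‖`).

Declarations (namespace `…Theorems`): `ae_const_eq_zero_of_hasTypeIDecay`;
`typeI_ancientMild_ae_zero_of_liouvilleConjectureNS`.
ALREADY IN THE TREE, therefore NOT re-proved here (lead A89, lit LIT-COVERAGE §12(3)): the Oseen-gauge
sibling `typeIAncientMild_eq_zero_of_liouvilleConjectureNS`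
(`Theorems/SqueezeCycleExtremalBiaxialitySubcriticalOfLiouville.lean`), the composition
`(L) → RotatedTypeIDSSLiouville c R` via `extremalBiaxialitySubcritical_of_liouvilleConjectureNS` and
`rotatedTypeIDSSLiouville_of_extremalBiaxialitySubcritical` (`…SubcriticalHardness.lean`), and
`FrequencyRigidity.TwoEndedPinning.typeIAncientLiouville_of_liouvilleConjectureNS`.

## References
* G. Koch, N. Nadirashvili, G. Seregin, V. Šverák, Acta Math. 203 (2009) 83–105 = arXiv:0709.3599,
  §1 p. 3 («any ancient mild solution with bounded velocity is constant»). [KochNadirashviliSereginSverak2009]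
* D. Albritton, T. Barker, arXiv:1811.00502, p. 3, paragraph before Thm 1.1 («If true, the conjecture
  excludes Type I singularities …»). [AlbrittonBarker2019]
-/

noncomputable section

set_option linter.dupNamespace false

namespace Summit.NavierStokesRegularity.NavierStokesRegularity.Theorems

open MeasureTheory Set Function Filter Topology Literature.Analysis.FluidPDE

/-- The Type-I constant of a field with Type-I space–time decay is nonnegative. [folklore] -/
private theorem hasTypeIDecay_const_nonneg {C₀ : ℝ} {u : ℝ → (EuclideanSpace ℝ (Fin 3)) → (EuclideanSpace ℝ (Fin 3))} (hTI : HasTypeIDecay C₀ u)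
    {t : ℝ} (ht : t < 0) : 0 ≤ C₀ := by
  have h1 := hTI t ht 0
  have hs : 0 < Real.sqrt (-t) := Real.sqrt_pos.2 (by linarith)
  rw [norm_zero, zero_add] at h1
  by_contra hneg
  have h2 : C₀ / Real.sqrt (-t) < 0 := div_neg_of_neg_of_pos (lt_of_not_ge hneg) hs
  linarith [norm_nonneg (u t 0)]

/-- **An a.e.-constant slice of a field with Type-I space–time decay vanishes**: if
`‖u(t,x)‖ ≤ C₀/(‖x‖ + √(−t))` and `u t = b` a.e., then `b = 0`. (Open sets have positive Lebesgue
measure, so for every `n` the a.e. identity holds at some `x` with `‖x‖ > n`, where `‖b‖ ≤ C₀/n`.)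
[folklore] -/
theorem ae_const_eq_zero_of_hasTypeIDecay {C₀ : ℝ} {u : ℝ → (EuclideanSpace ℝ (Fin 3)) → (EuclideanSpace ℝ (Fin 3))} (hTI : HasTypeIDecay C₀ u)
    {t : ℝ} (ht : t < 0) {b : (EuclideanSpace ℝ (Fin 3))} (hb : u t =ᵐ[volume] fun _ => b) : b = 0 := by
  have hC₀ : 0 ≤ C₀ := hasTypeIDecay_const_nonneg hTI ht
  have hbound : ∀ n : ℕ, 1 ≤ n → ‖b‖ ≤ C₀ / (n : ℝ) := by
    intro n hn
    have hn' : (0 : ℝ) < n := by exact_mod_cast hn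
    set S : Set (EuclideanSpace ℝ (Fin 3)) := {x | (n : ℝ) < ‖x‖} with hS_def
    have hSo : IsOpen S := isOpen_lt continuous_const continuous_norm
    have hSne : S.Nonempty := by
      obtain ⟨x₀, hx₀⟩ := exists_norm_eq (EuclideanSpace ℝ (Fin 3)) (show (0 : ℝ) ≤ (n : ℝ) + 1 by positivity)
      refine ⟨x₀, ?_⟩
      show (n : ℝ) < ‖x₀‖
      rw [hx₀]
      linarith
    have hSpos : volume S ≠ 0 := (hSo.measure_pos volume hSne).ne'
    haveI : (ae (volume.restrict S)).NeBot := by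
      rw [ae_neBot]
      rwa [Ne, Measure.restrict_eq_zero]
    have h1 : ∀ᵐ x ∂(volume.restrict S), u t x = b := ae_restrict_of_ae hb
    have h2 : ∀ᵐ x ∂(volume.restrict S), x ∈ S := ae_restrict_mem hSo.measurableSet
    obtain ⟨x, hx1, hx2⟩ := (h1.and h2).exists
    have hx2' : (n : ℝ) < ‖x‖ := hx2
    calc ‖b‖ = ‖u t x‖ := by rw [hx1]
      _ ≤ C₀ / (‖x‖ + Real.sqrt (-t)) := hTI t ht x
      _ ≤ C₀ / (n : ℝ) :=
          div_le_div_of_nonneg_left hC₀ hn' (by linarith [Real.sqrt_nonneg (-t)])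
  have hlim : Tendsto (fun n : ℕ => C₀ / (n : ℝ)) atTop (𝓝 0) :=
    tendsto_const_div_atTop_nhds_zero_nat C₀
  have hle : ‖b‖ ≤ 0 := ge_of_tendsto hlim (eventually_atTop.2 ⟨1, fun n hn => hbound n hn⟩)
  exact norm_le_zero_iff.mp hle

/-- **(L) ⇒ every Type-I ancient mild solution is trivial** (KNSS 2009 §1; Albritton–Barker 2019 §1,
elementary half): under `LiouvilleConjectureNS`, an ancient mild solution (`ν = 1`) with measurable
slices and the Type-I space–time bound `‖u(t,x)‖ ≤ C₀/(‖x‖ + √(−t))` is a.e. zero on every slice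
`t < 0`. No self-similarity is used. [cite: KochNadirashviliSereginSverak2009, §1] -/
theorem typeI_ancientMild_ae_zero_of_liouvilleConjectureNS
    (hL : Summit.NavierStokesRegularity.NavierStokesRegularity.LiouvilleConjectureNS)
    {u : ℝ → (EuclideanSpace ℝ (Fin 3)) → (EuclideanSpace ℝ (Fin 3))} {C₀ : ℝ} (hmild : IsAncientMildSolution 1 u)
    (hmeas : ∀ t < 0, AEStronglyMeasurable (u t) volume) (hTI : HasTypeIDecay C₀ u) :
    ∀ t < 0, u t =ᵐ[volume] 0 := by
  intro t ht
  have hC₀ : 0 ≤ C₀ := hasTypeIDecay_const_nonneg hTI ht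
  -- the shifted field `v τ = u (τ + t/2)` is a BOUNDED ancient mild solution
  set v : ℝ → (EuclideanSpace ℝ (Fin 3)) → (EuclideanSpace ℝ (Fin 3)) := fun τ => u (τ + t / 2) with hv
  have hshift : ∀ τ : ℝ, τ < 0 → τ + t / 2 < 0 := fun τ hτ => by linarith
  have hv_mild : IsAncientMildSolution 1 v := hmild.time_translate (s := t / 2) (by linarith)
  have hv_bdd : IsBoundedOn (Iio 0) v := by
    obtain ⟨K, hK⟩ := (hTI.hasTypeITimeDecay hC₀).isBoundedOn hC₀ (δ := -(t / 2)) (by linarith)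
    refine ⟨K, fun τ hτ x => hK (τ + t / 2) ?_ x⟩
    simp only [mem_Iio] at hτ ⊢
    linarith
  have hv_meas : ∀ τ < 0, AEStronglyMeasurable (v τ) volume := fun τ hτ => hmeas _ (hshift τ hτ)
  -- (L) for the shifted field, read at `τ = t/2`
  obtain ⟨b, hb⟩ := hL v ⟨hv_mild, hv_bdd⟩ hv_meas (t / 2) (by linarith)
  have e : v (t / 2) = u t := by simp only [hv, add_halves]
  rw [e] at hb
  have hb0 : b = 0 := ae_const_eq_zero_of_hasTypeIDecay hTI ht hb
  rw [hb0] at hb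
  exact hb

end Summit.NavierStokesRegularity.NavierStokesRegularity.Theorems

end
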